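import Summits.Ventures.PercRepro.C041PendantClass

/-!
# ROW C-041 — SUMMARY of p6 gen 29: the tree bridge and THEOREM (PENDANT ZONE), every end theorem restated with all
its hypotheses in the type (the referees' tree-read form)

* `row_C041_tree_zone` — mine-3's CONJECTURE (ZONE O-CUBE) holds on the zone of every rooted marked tree with its
  root as the anchor (`C041TreeZoneBridge`); `row_C041_tree_zone_cs` its (CS) sharpening; `row_C041_tree_zone_forced`
  the forced-edge form (`C041TreeZoneBridgeF`); `row_C041_tree_zone_iso` on every zone isomorphic to one
  (`C041TreeZoneBridgeIso`).
* `row_C041_pendant` — THEOREM (PENDANT ZONE) (C-041.md §20 (b)): the invariant (P) propagates through hanging any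
  zone at any vertex of any unmarked multigraph; `row_C041_pendant_oCube` the ZONE O-CUBE on the glued zone
  (`C041PendantCounts`).
* `row_C041_pendant_class` — the ZONE O-CUBE on the pendant-generated class 𝒵₁ (`C041PendantClass`).
-/

namespace PercRepro

namespace ZoneZ

open ZoneData TreeClosure Pendant Finset

/-- THEOREM (trees) in the tree's own language: the ZONE O-CUBE on the zone of every rooted marked tree. -/
theorem row_C041_tree_zone (t : TZ) : t.toZone.ZoneOCubeConj {t.root} (∅ : Set t.Pos) :=
  t.zoneOCubeConj_toZone

/-- Its (CS) sharpening on the zone of every rooted marked tree. -/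
theorem row_C041_tree_zone_cs (t : TZ) : t.toZone.ZoneCSConj {t.root} (∅ : Set t.Pos) :=
  t.zoneCSConj_toZone

/-- The forced-edge form (the crux form of the typed chain) on the zone of every rooted marked tree. -/
theorem row_C041_tree_zone_forced (t : TZ) : t.toZone.toFZone.ZoneOCubeConjF {t.root} (∅ : Set t.Pos) :=
  t.zoneOCubeConjF_toZone

/-- THEOREM (trees) on every zone isomorphic to the zone of a tree. -/
theorem row_C041_tree_zone_iso {V E T₁ T₂ : Type*} [Fintype E] [DecidableEq E] [Fintype T₁] [DecidableEq T₁]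
    [Fintype T₂] [DecidableEq T₂] (t : TZ) (Z : ZoneData V E T₁ T₂) (φ : ZoneIso t.toZone Z) :
    Z.ZoneOCubeConj {φ.v t.root} (∅ : Set V) :=
  t.zoneOCubeConj_of_iso φ

/-- THEOREM (PENDANT ZONE): (P) of `Z₂` at `a₂` gives (P) of the zone `Z₂` hung at the vertex `u` of the unmarked
multigraph `Z₁`, anchored at `a`. -/
theorem row_C041_pendant {V₁ E₁ U₁ U₂ V₂ E₂ T₁ T₂ : Type*} [Fintype E₁] [DecidableEq E₁] [Fintype E₂]
    [DecidableEq E₂] [Fintype T₁] [DecidableEq T₁] [Fintype T₂] [DecidableEq T₂] (Z₁ : ZoneData V₁ E₁ U₁ U₂)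
    (u a : V₁) (Z₂ : ZoneData V₂ E₂ T₁ T₂) (a₂ : V₂)
    (h : K4 (#(Z₂.Fset a₂) : ℝ) (#(Z₂.T1set a₂)) (#(Z₂.T2set a₂)) (#(Z₂.Iset a₂))) :
    K4 (#((pendant Z₁ u Z₂ a₂).Fset (Sum.inl a)) : ℝ) (#((pendant Z₁ u Z₂ a₂).T1set (Sum.inl a)))
      (#((pendant Z₁ u Z₂ a₂).T2set (Sum.inl a))) (#((pendant Z₁ u Z₂ a₂).Iset (Sum.inl a))) :=
  K4_pendant Z₁ u Z₂ a₂ a h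

/-- THEOREM (PENDANT ZONE), O-cube form: the ZONE O-CUBE on the glued zone. -/
theorem row_C041_pendant_oCube {V₁ E₁ U₁ U₂ V₂ E₂ T₁ T₂ : Type*} [Fintype E₁] [DecidableEq E₁] [Fintype E₂]
    [DecidableEq E₂] [Fintype T₁] [DecidableEq T₁] [Fintype T₂] [DecidableEq T₂] (Z₁ : ZoneData V₁ E₁ U₁ U₂)
    (u a : V₁) (Z₂ : ZoneData V₂ E₂ T₁ T₂) (a₂ : V₂)
    (h : K4 (#(Z₂.Fset a₂) : ℝ) (#(Z₂.T1set a₂)) (#(Z₂.T2set a₂)) (#(Z₂.Iset a₂))) :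
    (pendant Z₁ u Z₂ a₂).ZoneOCubeConj {Sum.inl a} (∅ : Set (V₁ ⊕ V₂)) :=
  zoneOCubeConj_pendant Z₁ u Z₂ a₂ a h

/-- The ZONE O-CUBE on the pendant-generated class 𝒵₁ (trees, one-marked-vertex zones, pendant attachments,
isomorphic copies). -/
theorem row_C041_pendant_class {V E T₁ T₂ : Type} (Z : ZoneData V E T₁ T₂) (k : V) (h : IsZ Z k) [Fintype E]
    [DecidableEq E] [Fintype T₁] [DecidableEq T₁] [Fintype T₂] [DecidableEq T₂] :
    Z.ZoneOCubeConj {k} (∅ : Set V) :=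
  h.zoneOCubeConj

end ZoneZ

end PercRepro
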